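import Summits.ResolutionOfSingularities.ResolutionOfSingularities.Theorems.MarkedTransferCampaignW46ProcrastinationPlane
import HarnessLib

/-!
# [OURS · L1 W4.6 rung (i), negative half — ∇-centred form] `TerminatesNabla` is refuted for every notion instance
# whose résumés admit ONE-POINT terminal plats at states with infinite singular locus: why a «hence terminates» rung
# must NAME its notion instance
# (cell res-hironaka, LADDER-RESOLUTION rung L, D-0089; campaign s46, prover res-L1-s46-pv-1; host route
# MarkedTransfer, `--supports stmt-ResolutionOfSingularities-16155`)

HONEST FRAMING. Nothing here is a statement of H. Hironaka's manuscript (2017-03-23, [Hironaka2017]) and nothing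
here asserts or denies any statement of it. The shared campaign module (res-L1-type-o1, v3 p468540) reads «hence
terminates» (Th. 16.13 p.87 l.26–28) on `CampaignW46.TerminatesNabla N Rd Rg` — no infinite run whose centres are
irreducible COMPONENTS of the terminal plats `∇(E_k)` — and records (docstring (VAC)) that this remains «refutable by
junk notion instances `N`, so rungs name `N`». This file is the KERNEL FORM of that remark: the procrastination
engine of `MarkedTransferCampaignW46LiteralCentreProcrastination` run at a point `x` with `∇(E) = {x}` is a ∇-step
(`{x}` is then the unique component of `∇(E)`), so ∇-centred termination in `dimLE d` (`d ≥ 2`) fails for every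
instance `N` whose résumés COVER the standard states with infinite singular locus BY ONE-POINT PLATS
(`PointPlatCover`, hypothesis). The intended instance is expected NOT to have this property (its `∇(E)` should be a
whole stratum); the theorem says precisely which property of `N` a `TerminatesNabla` rung in dimension `≥ 2` must
exploit. All geometry is inherited from the companion modules (tree theorems); AI review is weaker than expert
review. No `sorry`; axioms standard.

## Contents

* `exists_procrastinatingStep_at` — the engine at a GIVEN closed point `x ∈ ∇(E)` (centre `{x}`).
* `PointPlatCover N Rd S` — «every state in `S` has a résumé read by `Rd` whose terminal plat is a single point».
* `isNablaComponent_of_nabla_eq` — if `∇(E) = D` as sets (and `D` is a literal centre) then `D` is a ∇-component.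
* `NState`, `NState.next`, `NState.seq`, `procrastinationNabla` — the infinite ∇-centred run.
* `not_terminatesNabla_dimLE_of_pointPlatCover` (any initial state) and
  `not_terminatesNabla_dimLE_of_pointPlatCover_plane` (initial state = the plane with `(𝓘_{x₁=0}, 1)`, `d ≥ 2`).

## References

* companion modules `MarkedTransferCampaignW46TypedProcedure` (v3: `IsNablaComponent`, `StepNabla`, `RunNabla`,
  `TerminatesNabla`, DESIGN POINT (CMP), (VAC)), `MarkedTransferCampaignW46LiteralCentreProcrastination`,
  `MarkedTransferCampaignW46ProcrastinationPlane`.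
* H. Hironaka, ms. 2017-03-23, Th. 16.6 (4) p.84 l.29 («`D = ∇`»), §16.3 p.87 l.14–28 — scope only, under
  adjudication, not cited as fact. [Hironaka2017]
-/

noncomputable section

set_option linter.dupNamespace false -- mandated namespace of this single-conjunct summit

open CategoryTheory AlgebraicGeometry TopologicalSpace

namespace Summit.ResolutionOfSingularities.ResolutionOfSingularities.Theorems

namespace CampaignW46

open Literature.AlgebraicGeometry.Resolution
open Literature.AlgebraicGeometry.Hironaka2017.S02Preliminaries
open Literature.AlgebraicGeometry.Hironaka2017.Datum
open Literature.AlgebraicGeometry.Hironaka2017.S15ARSchemes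
open Literature.AlgebraicGeometry.Hironaka2017.S16Proof
open Scheme.IdealSheafData

universe u

variable {n : ℕ} {p : ℕ} [Fact p.Prime] {K : Type u} [Field K] [CharP K p]

/-! ## Coverage by one-point plats -/

/-- [OURS · L1 W4.6] NOT a statement of the manuscript. «The typed procedure (instance `N`, reading `Rd`) has, for
every state in the class `S`, a résumé whose terminal plat `∇(E)` is a SINGLE POINT» — the property of a (junk)
notion instance under which ∇-centred termination is refutable by point towers. [folklore] -/
def PointPlatCover (N : Notions.{u} n) (Rd : Reading p K N)
    (S : ∀ A : AmbientDatum p K, IdealExponent A.Z → Prop) : Prop :=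
  ∀ (A : AmbientDatum p K) (E : IdealExponent A.Z), S A E →
    ∃ R : Resume N A E, Rd A E R ∧ ∃ x : A.Z, (R.nabla : Set A.Z) = {x}

/-- Pure logic: a literal centre that is ALL of `∇(E)` (as a set) is an irreducible component of `∇(E)`. [folklore] -/
theorem isNablaComponent_of_nabla_eq {N : Notions.{u} n} {A : AmbientDatum p K} {E : IdealExponent A.Z}
    {R : Resume N A E} {D : Closeds A.Z} (hc : IsCentre R D) (h : (R.nabla : Set A.Z) = (D : Set A.Z)) :
    IsNablaComponent R D where
  subset_nabla := hc.subset_nabla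
  irreducible := hc.irreducible
  maximal _ _ hDS hSN := Set.Subset.antisymm (hSN.trans h.le) hDS

/-! ## The engine at a given point -/

section Step

variable [PerfectField K] {N : Notions.{u} n} {Rd : Reading p K N}

/-- **The engine at a given closed point.** [OURS · L1 W4.6] NOT a statement of the manuscript. At a state with
résumé `R`, infinite `Sing(E)` and a CLOSED point `x ∈ ∇(E)`: the literal rule admits the centre `{x}`, the
blow-up at `x` is an ambient datum of no larger dimension, and the transform is standard with infinite singular
locus (same proof as `exists_procrastinatingStep`, which chooses `x` by the Jacobson property). [folklore] -/
theorem exists_procrastinatingStep_at {A : AmbientDatum p K} {E : IdealExponent A.Z} (R : Resume N A E)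
    (hinf : E.sing.Infinite) {x : A.Z} (hxN : x ∈ (R.nabla : Set A.Z)) (hxcl : IsClosed ({x} : Set A.Z)) :
    ∃ (A' : AmbientDatum p K) (s : Step R A'),
      (s.D : Set A.Z) = {x} ∧ s.E'.IsStandard ∧ s.E'.sing.Infinite ∧
        ∀ d : ℕ, topologicalKrullDim A.Z ≤ (d : WithBot ℕ∞) → topologicalKrullDim A'.Z ≤ (d : WithBot ℕ∞) := by
  classical
  haveI := A.smooth
  haveI := A.irreducible
  haveI := A.quasiCompact
  haveI : IsLocallyNoetherian A.Z := ambient_isLocallyNoetherian A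
  haveI : IsIntegral A.Z := ambient_isIntegral A
  have hZreg : Scheme.IsRegular A.Z := ambient_isRegular A
  let D : Closeds A.Z := ⟨{x}, hxcl⟩
  -- the literal centre rule admits `{x}`
  have hreg : Scheme.IsRegular (vanishingIdeal D).subscheme := isRegular_subscheme_vanishingIdeal_singleton hxcl
  have hcentre : IsCentre R D :=
    { subset_nabla := Set.singleton_subset_iff.2 hxN
      irreducible := isIrreducible_singleton
      smooth := smooth_of_isRegular_of_perfectField _ hreg }
  -- the blow-up of `Z` at `x`
  obtain ⟨Z', π, hπ⟩ := exists_isBlowup A.Z (vanishingIdeal D)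
  have hE : E.IsStandard := R.mti_isStandard.1
  obtain ⟨y, hy, hyx⟩ : ∃ y ∈ E.sing, y ≠ x := by
    by_contra! h
    exact hinf ((Set.finite_singleton x).subset fun y hy => h y hy)
  have hne : ({x} : Set A.Z) ≠ Set.univ := fun h => hyx (by
    have : y ∈ ({x} : Set A.Z) := h ▸ Set.mem_univ y
    exact this)
  have hDtop : (vanishingIdeal D).support ≠ ⊤ := by
    intro h
    apply hne
    have := congrArg (fun S : Closeds A.Z => (S : Set A.Z)) h
    simpa [coe_support_vanishingIdeal, D] using this
  have hDne : vanishingIdeal D ≠ ⊥ := fun h => hDtop (by rw [h, Scheme.IdealSheafData.support_bot])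
  haveI : IsIntegral Z' := hπ.isIntegral hDne
  haveI : IsProper π := hπ.isProper
  have hZ'reg : Scheme.IsRegular Z' := hπ.isRegular_of_isRegular_subscheme hZreg hreg
  haveI : Smooth (π ≫ A.hom) := smooth_of_isRegular_of_perfectField _ hZ'reg
  let A' : AmbientDatum p K :=
    { Z := Z', hom := π ≫ A.hom, irreducible := inferInstance, smooth := inferInstance,
      quasiCompact := inferInstance }
  let s : Step R A' := { D := D, centre := hcentre, π := π, hom_eq := rfl, blowup := hπ }
  haveI : IsLocallyNoetherian A'.Z := ambient_isLocallyNoetherian A'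
  refine ⟨A', s, rfl, ⟨?_, hE.2⟩, ?_, fun d hd => hπ.topologicalKrullDim_le hd⟩
  · intro hbot
    apply hπ.comap_ne_bot hDtop hE.1
    have hle : E.J.comap π ≤ (s.E').J := comap_le_controlledTransform π (vanishingIdeal D) E.J E.b
    rw [hbot] at hle
    exact le_bot_iff.1 hle
  · exact sing_transform_infinite hxcl hπ E hinf

/-- The engine packaged as a ∇-STEP when the terminal plat is the single point `x`. [folklore] -/
theorem exists_stepNabla_of_nabla_eq_singleton {A : AmbientDatum p K} {E : IdealExponent A.Z}
    (R : Resume N A E) (hinf : E.sing.Infinite) {x : A.Z} (hN : (R.nabla : Set A.Z) = {x}) :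
    ∃ (A' : AmbientDatum p K) (s : StepNabla R A'),
      s.toStep.E'.IsStandard ∧ s.toStep.E'.sing.Infinite ∧
        ∀ d : ℕ, topologicalKrullDim A.Z ≤ (d : WithBot ℕ∞) → topologicalKrullDim A'.Z ≤ (d : WithBot ℕ∞) := by
  have hxcl : IsClosed ({x} : Set A.Z) := by
    rw [← hN]; exact R.nabla.isClosed
  have hxN : x ∈ (R.nabla : Set A.Z) := by rw [hN]; exact Set.mem_singleton x
  obtain ⟨A', s, hD, hst, hinf', hdim⟩ := exists_procrastinatingStep_at R hinf hxN hxcl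
  exact ⟨A', ⟨s, isNablaComponent_of_nabla_eq s.centre (hN.trans hD.symm)⟩, hst, hinf', hdim⟩

end Step

/-! ## The infinite ∇-centred run -/

section Run

variable [PerfectField K] {N : Notions.{u} n} {Rd : Reading p K N} {d : ℕ}

/-- [OURS · L1 W4.6] Bookkeeping: a state of the ∇-centred procrastinating run (dimension `≤ d`, infinite singular
locus, a résumé read by `Rd` with ONE-POINT terminal plat). [folklore] -/
structure NState (N : Notions.{u} n) (Rd : Reading p K N) (d : ℕ) where
  /-- ambient datum -/
  A : AmbientDatum p K
  /-- ideal exponent -/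
  E : IdealExponent A.Z
  /-- résumé -/
  R : Resume N A E
  /-- read by `Rd` -/
  reads : Rd A E R
  /-- dimension bound -/
  dim : topologicalKrullDim A.Z ≤ (d : WithBot ℕ∞)
  /-- infinite singular locus -/
  inf : E.sing.Infinite
  /-- the terminal plat is a single point -/
  pt : ∃ x : A.Z, (R.nabla : Set A.Z) = {x}

/-- [OURS · L1 W4.6] Bookkeeping: a ∇-step out of a state, with its target state. [folklore] -/
structure NState.Link (S : NState N Rd d) where
  /-- the next state -/
  S' : NState N Rd d
  /-- the ∇-step -/
  s : StepNabla S.R S'.A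
  /-- the next ideal exponent is the transform -/
  hE : S'.E = s.toStep.E'

/-- The next state exists (engine + one-point-plat coverage). [folklore] -/
theorem NState.nonempty_link
    (hcov : PointPlatCover N Rd fun A E => topologicalKrullDim A.Z ≤ (d : WithBot ℕ∞) ∧ E.IsStandard ∧ E.sing.Infinite)
    (S : NState N Rd d) : Nonempty S.Link := by
  obtain ⟨x, hx⟩ := S.pt
  obtain ⟨A', s, hst, hinf, hdim⟩ := exists_stepNabla_of_nabla_eq_singleton S.R S.inf hx
  obtain ⟨R', hR', hpt⟩ := hcov A' s.toStep.E' ⟨hdim d S.dim, hst, hinf⟩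
  exact ⟨⟨⟨A', s.toStep.E', R', hR', hdim d S.dim, hinf, hpt⟩, s, rfl⟩⟩

/-- A chosen next state. [folklore] -/
def NState.next
    (hcov : PointPlatCover N Rd fun A E => topologicalKrullDim A.Z ≤ (d : WithBot ℕ∞) ∧ E.IsStandard ∧ E.sing.Infinite)
    (S : NState N Rd d) : S.Link :=
  Classical.choice (S.nonempty_link hcov)

/-- The sequence of states from an initial one. [folklore] -/
def NState.seq
    (hcov : PointPlatCover N Rd fun A E => topologicalKrullDim A.Z ≤ (d : WithBot ℕ∞) ∧ E.IsStandard ∧ E.sing.Infinite)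
    (S₀ : NState N Rd d) : ℕ → NState N Rd d
  | 0 => S₀
  | k + 1 => ((NState.seq hcov S₀ k).next hcov).S'

/-- [OURS · L1 W4.6] NOT a statement of the manuscript. **The ∇-centred procrastinating run** (every centre is the
whole one-point terminal plat of its stage). [folklore] -/
def procrastinationNabla
    (hcov : PointPlatCover N Rd fun A E => topologicalKrullDim A.Z ≤ (d : WithBot ℕ∞) ∧ E.IsStandard ∧ E.sing.Infinite)
    (S₀ : NState N Rd d) : RunNabla N Rd where
  A k := (S₀.seq hcov k).A
  E k := (S₀.seq hcov k).E
  R k := (S₀.seq hcov k).R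
  reads k := (S₀.seq hcov k).reads
  step k := ((S₀.seq hcov k).next hcov).s
  E_succ k := ((S₀.seq hcov k).next hcov).hE

/-- Every stage of the ∇-centred procrastinating run lies in `dimLE d`. [folklore] -/
theorem procrastinationNabla_dimLE
    (hcov : PointPlatCover N Rd fun A E => topologicalKrullDim A.Z ≤ (d : WithBot ℕ∞) ∧ E.IsStandard ∧ E.sing.Infinite)
    (S₀ : NState N Rd d) (k : ℕ) :
    Regime.dimLE d ((procrastinationNabla hcov S₀).A k) ((procrastinationNabla hcov S₀).E k) :=
  (S₀.seq hcov k).dim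

end Run

/-! ## The theorems -/

/-- **∇-centred procrastination.** [OURS · L1 W4.6] NOT a statement of the manuscript and not a claim about it. Over
a perfect field, for every notion instance `N` and reading `Rd`: if the résumés of `N` COVER the standard states
with infinite singular locus in dimension `≤ d` BY ONE-POINT terminal plats (`PointPlatCover`) and one such state
exists, then `¬ TerminatesNabla N Rd (Regime.dimLE d)`. (So a ∇-centred termination rung in dimension `≥ 2` must
use a property of its NAMED instance `N` that rules out one-point plats on positive-dimensional singular loci.)
[folklore] -/
theorem not_terminatesNabla_dimLE_of_pointPlatCover [PerfectField K] (N : Notions.{u} n) (Rd : Reading p K N)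
    (d : ℕ)
    (hcov : PointPlatCover N Rd fun A E => topologicalKrullDim A.Z ≤ (d : WithBot ℕ∞) ∧ E.IsStandard ∧ E.sing.Infinite)
    {A₀ : AmbientDatum p K} {E₀ : IdealExponent A₀.Z} (h₀d : topologicalKrullDim A₀.Z ≤ (d : WithBot ℕ∞))
    (h₀s : E₀.IsStandard) (h₀i : E₀.sing.Infinite) : ¬ TerminatesNabla N Rd (Regime.dimLE d) := by
  obtain ⟨R₀, hR₀, hpt⟩ := hcov A₀ E₀ ⟨h₀d, h₀s, h₀i⟩
  let S₀ : NState N Rd d := ⟨A₀, E₀, R₀, hR₀, h₀d, h₀i, hpt⟩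
  exact fun hT => hT (procrastinationNabla hcov S₀) (procrastinationNabla_dimLE hcov S₀)

/-- **∇-centred procrastination from the plane.** [OURS · L1 W4.6] NOT a statement of the manuscript. For every
`N`, `Rd` and `d ≥ 2` over a perfect field of characteristic `p`: one-point-plat coverage of the standard states
with infinite singular locus in dimension `≤ d` refutes `TerminatesNabla N Rd (Regime.dimLE d)` (initial state: the
plane `Spec K[x₀,x₁]` with `(𝓘_{x₁=0}, 1)`). [folklore] -/
theorem not_terminatesNabla_dimLE_of_pointPlatCover_plane [PerfectField K] (N : Notions.{u} n)
    (Rd : Reading p K N) {d : ℕ} (hd : 2 ≤ d)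
    (hcov : PointPlatCover N Rd fun A E =>
      topologicalKrullDim A.Z ≤ (d : WithBot ℕ∞) ∧ E.IsStandard ∧ E.sing.Infinite) :
    ¬ TerminatesNabla N Rd (Regime.dimLE d) := by
  have h₀d : topologicalKrullDim (planeAmbientDatum p K).Z ≤ (d : WithBot ℕ∞) :=
    (planeAmbientDatum_dimLE_two p K).trans (by exact_mod_cast hd)
  exact not_terminatesNabla_dimLE_of_pointPlatCover N Rd d hcov h₀d (planeLineExponent_isStandard p K)
    (planeLineExponent_sing_infinite p K)

end CampaignW46

end Summit.ResolutionOfSingularities.ResolutionOfSingularities.Theorems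

end
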